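import Summits.AtomisticToContinuum.Crystallization.Theorems.FreeSplittingCertificatesStrictSplittingRuleCoreFirstOrderDesignGeometry

/-!
# `StrictSplittingRule` (stmt-AtomisticToContinuum-12560): the quadratic frame identity of the first-order stencil

Route `FreeSplittingCertificates`, crux r3 `StrictSplittingRule`, line `registered` (unit b2b-freesplit-B, gen 8).  The frame identity
`Σ_{s ∈ Y₁} λ_s ⟪x, y_s⟫ y_s = x` of the first-order stencil (`h1_frame`; `λ = 2/(3a²)` in the layer, `1/(4h²)` on the `c`-axis step) has
the quadratic companion recorded here: for any three vectors `g₀, g₁, g₂` (the columns of a gradient `∇v`),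
`Σ_{s ∈ Y₁} λ_s ‖Σ_i (y_s)_i g_i‖² = Σ_i ‖g_i‖²` — i.e. `Σ_s λ_s ‖(∇v) y_s‖² = |∇v|²_F` for EVERY `(a, h)`.  With the leading-order line-truss
coefficient `β → λ_s r⁻⁶/12` (`h1_tau_asymp`, `…LineTrussAsymptoticsTau.lean`) this is why the readout demand of the H12⋆ far lemma has the
ISOTROPIC continuum density `(1/24) r⁻⁶ |∇v|²` (HOME CERT.md §16 (2)), so that it separates in vector spherical harmonics.
Structural bookkeeping ([folklore]); VALUE = a kernel-checked brick — NOT summit progress.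
-/

noncomputable section

namespace Summit.AtomisticToContinuum.Crystallization.Theorems.StrictSplittingRuleBirth

open scoped BigOperators
open Literature.MathematicalPhysics.StatisticalMechanics
open Summit.AtomisticToContinuum.Crystallization.Theorems.PalmUnimodularRigidity.LayeredLawsSelectHcp

/-- **Quadratic frame identity**: `Σ_{s ∈ Y₁} λ_s ‖(y_s)₀ g₀ + (y_s)₁ g₁ + (y_s)₂ g₂‖² = ‖g₀‖² + ‖g₁‖² + ‖g₂‖²` for all `g₀ g₁ g₂`
(`a, h ≠ 0`): the readout stencil weighted by `λ_s` is a tight frame, so `Σ_s λ_s‖(∇v)y_s‖² = |∇v|²`. [folklore] -/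
theorem h1_frame_sq {a h : ℝ} (ha : a ≠ 0) (hh : h ≠ 0) (g₀ g₁ g₂ : EuclideanSpace ℝ (Fin 3)) :
    ∑ s ∈ ({(0, 1, 0), (0, 0, 1), (0, -1, 1), (2, 0, 0)} : Finset (ℤ × ℤ × ℤ)),
      (if s.1 = 0 then 2 / (3 * a ^ 2) else 1 / (4 * h ^ 2)) *
        ‖hcpSite a h s 0 • g₀ + hcpSite a h s 1 • g₁ + hcpSite a h s 2 • g₂‖ ^ 2 =
      ‖g₀‖ ^ 2 + ‖g₁‖ ^ 2 + ‖g₂‖ ^ 2 := by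
  obtain ⟨⟨u0, u1, u2⟩, ⟨v0, v1, v2⟩, ⟨w0, w1, w2⟩, ⟨z0, z1, z2⟩⟩ := h1_stencil_coord a h
  have h3 : (√3 : ℝ) ^ 2 = 3 := Real.sq_sqrt (by norm_num)
  rw [Finset.sum_insert (by decide), Finset.sum_insert (by decide), Finset.sum_insert (by decide),
    Finset.sum_singleton]
  simp only [u0, u1, u2, v0, v1, v2, w0, w1, w2, z0, z1, z2, zero_smul, add_zero, zero_add]
  have e00 : ‖a • g₀‖ ^ 2 = a ^ 2 * ‖g₀‖ ^ 2 := by rw [norm_smul, mul_pow, Real.norm_eq_abs, sq_abs]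
  have e22 : ‖(2 * h) • g₂‖ ^ 2 = 4 * h ^ 2 * ‖g₂‖ ^ 2 := by
    rw [norm_smul, mul_pow, Real.norm_eq_abs, sq_abs]; ring
  have ev : ‖(a / 2) • g₀ + (a * √3 / 2) • g₁‖ ^ 2 =
      (a / 2) ^ 2 * ‖g₀‖ ^ 2 + 2 * ((a / 2) * (a * √3 / 2)) * inner ℝ g₀ g₁ + (a * √3 / 2) ^ 2 * ‖g₁‖ ^ 2 := by
    rw [norm_add_sq_real, norm_smul, norm_smul, mul_pow, mul_pow, Real.norm_eq_abs, Real.norm_eq_abs, sq_abs, sq_abs,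
      real_inner_smul_left, real_inner_smul_right]
    ring
  have ew : ‖(-(a / 2)) • g₀ + (a * √3 / 2) • g₁‖ ^ 2 =
      (a / 2) ^ 2 * ‖g₀‖ ^ 2 - 2 * ((a / 2) * (a * √3 / 2)) * inner ℝ g₀ g₁ + (a * √3 / 2) ^ 2 * ‖g₁‖ ^ 2 := by
    rw [norm_add_sq_real, norm_smul, norm_smul, mul_pow, mul_pow, Real.norm_eq_abs, Real.norm_eq_abs, sq_abs, sq_abs,
      real_inner_smul_left, real_inner_smul_right]
    ring
  simp only [if_true, show ((2 : ℤ) = 0) = False by norm_num, if_false]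
  rw [e00, ev, ew, e22]
  field_simp
  linear_combination (2 * ‖g₁‖ ^ 2) * h3

end Summit.AtomisticToContinuum.Crystallization.Theorems.StrictSplittingRuleBirth

end
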